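import Literature.Geometry.Kaehler.SiegelTorusThetaDivisorDecomposableGaussMap
import Literature.LinearAlgebra.Matrix.ABVersusBAJordanStructure
import HarnessLib

/-!
# The rank of the bordered Hessian on a decomposable theta divisor `Θ_{Ω₁ ⊕ Ω₂}`: on the first sheet
# `rank B_{ϑ(·,Ω₁⊕Ω₂)}(v)[e] = rank B_{ϑ(·,Ω₁)}(v|_{ℂ^{n₁}})[e′] ≤ n₁ + 1`, on the second sheet the same with
# `Ω₂`, and along the whole `Sp_{2g}(ℤ)`-orbit (the decomposable locus) — the Thom–Boardman type of the
# Gauss map of `Θ₁ × X₂ ∪ X₁ × Θ₂` is that of the factor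

[tag: lange-cav-complex-tori] [linked: HodgeConjecture (lit-hodgefound SKELETON §A2, row A2-221)]

Layer `Literature/Geometry/Kaehler`, namespaces `Literature.Geometry.Kaehler.SCV` (§1) and `.ComplexTorus` (§2–§3);
lane `lit-hodgefound` (Track 2 foundations library), skeleton seat `lit-hodgefound-skel-2` (generation 44), plan row
A2-221 = pointer (83) of the gen-43 list: the RANK companion of A2-213 (`SiegelTorusThetaDivisorDecomposableGaussMap`:
`det B ≡ 0` on `Θ_{Ω₁⊕Ω₂}` and on its `Sp_{2g}(ℤ)`-orbit), i.e. A2-209 (`ComplexTorusBoxDivisorSecondFundamentalFormRank`: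
`rank B_{F ⊠ G}(z) = rank B_F(z₁)` in the abstract model `WithLp 2 (V₁ × V₂)`) in SIEGEL coordinates
`Z = Ω₁ ⊕ Ω₂`, `ϑ(z, Ω₁ ⊕ Ω₂) = ϑ(z₁, Ω₁) ϑ(z₂, Ω₂)`, transported along the orbit by A2-210
(`rank_borderedHessian_riemannThetaChar_moeb_mulVec_eq`: the rank of the bordered Hessian on `ϑ = 0` is a modular
invariant). Theorems only; no definition, no named fact.

Sources, VERBATIM. R. de Jong, *Theta functions on the theta divisor*, Rocky Mountain J. Math. 40 (2010) [held
`paper:arxiv-math_0611810`], Prop. 2.3 and proof (chunk p0004): "Assume that `(A,Θ)` is decomposable […] we can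
write `θ = F(z_1,…,z_k) G(z_{k+1},…,z_g)` […] On `ℂⁿ` we have `ᵗ(θ_i) = (F_iG, FG_i)` and
`(θ_{ij}) = ( F_{ij}G  F_iG_j ; F_jG_i  FG_{ij} )` […] the last `g − k` columns of `(θ_{ij} θ_i ; θ_j 0)` […] span
a space of dimension at most `g − k − 1`"; §1 (chunk p0003): "the Gauss map on `Θ^s` is generically finite exactly
when `(A,Θ)` is indecomposable". S. Grushevsky, R. Salvati Manni, IMRN 2007, Lemma 2 (chunk p0007): "`dF` ramifies
at `x ∈ X` if and only if the matrix `( ∂ᵢ∂ⱼF ∂ᵢF ; ∂ⱼF 0 )` does not have maximal rank". D. Eisenbud, J. Harris,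
*3264 and All That* (2016), Thm. 7.11 (p0291): "The set of points `X_i ⊂ X` where the rank of the quadratic form
`S(f)_p` is at most `i`". Ch. Birkenhake, H. Lange, *Complex Abelian Varieties* (1992), §2.2.3 (p. 94: for the
product divisor "all fibres of `G` are of dimension `≥ 1`").

Dictionary. `B_f(z)[b] = ( D²f(z)(bᵢ,bⱼ) df(z)(bᵢ) ; df(z)(bⱼ) 0 )` (A2-200) in a family `b`; `e_k = Pi.single k 1`
on `ℂ^{n₁+n₂}`, `e′`, `e″` the standard families of `ℂ^{n₁}`, `ℂ^{n₂}`; `P₁ z = z|_{ℂ^{n₁}}` (`i ↦ z(castAdd i)`),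
`P₂ z = z|_{ℂ^{n₂}}` (`j ↦ z(natAdd j)`); `Ω = reindex(fromBlocks Ω₁ 0 0 Ω₂)`; `D = denom(M,Ω) = γΩ + δ`.

## Contents

* §1 (linear algebra of bordered matrices, any `E`) `bordered_comp_equiv` (`B[b ∘ σ] = B[b].submatrix (σ ⊕ 1) (σ ⊕ 1)`),
  `rank_bordered_comp_equiv`, **`bordered_sumElim_zero_submatrix`** (in the family `(b₁, 0, …, 0)` on `ι₁ ⊕ ι₂` the
  bordered matrix is `B[b₁] ⊕ 0` after the shuffle `(ι₁ ⊕ 1) ⊕ ι₂ ≃ (ι₁ ⊕ ι₂) ⊕ 1`), **`rank_bordered_sumElim_zero`**,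
  `rank_bordered_sumElim_zero_left` (zero vectors in the family do not change the rank).
* §2 (Siegel, `Z = Ω₁ ⊕ Ω₂`) `restrictFst_single_castAdd`, `restrictSnd_single_natAdd` (`P₁e_{castAdd i} = e′ᵢ`,
  `P₂e_{natAdd j} = e″ⱼ`), **`rank_borderedHessian_riemannTheta_blockDiag_eq_of_fst`** — on the first sheet
  (`ϑ(P₁v, Ω₁) = 0`, `ϑ(P₂v, Ω₂) ≠ 0`): `rank B_{ϑ(·,Ω)}(v)[e] = rank B_{ϑ(·,Ω₁)}(P₁v)[e′]` ("`(θ_{ij} θ_i; θ_j 0)`" has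
  the rank of its `F`-block: de Jong's columns, A2-207 `rank_borderedHessian_mul`, A2-213 `bordered_comp_clm`, §1);
  **`rank_borderedHessian_riemannTheta_blockDiag_eq_of_snd`** (second sheet);
  `rank_borderedHessian_riemannTheta_blockDiag_le_of_fst` (`≤ n₁ + 1`: never maximal when `n₂ ≥ 1` — the rank form
  of A2-213's `det = 0`).
* §3 (the orbit) **`rank_borderedHessian_riemannThetaChar_moeb_blockDiag_eq_of_fst`**: for `M ∈ Sp_{2g}(ℤ)`,
  `g = n₁ + n₂ ≥ 1`, at `w = ᵗD⁻¹v` with `v` on the first sheet,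
  `rank B_{ϑ[M[0]](·, M(Ω₁⊕Ω₂))}(w)[e] = rank B_{ϑ(·,Ω₁)}(P₁v)[e′]` — the Thom–Boardman type of the Gauss map of the
  theta divisor of every p.p.a.v. of the decomposable locus at a point of the first sheet is that of `Θ₁` at the
  first component.

## References

* [DeJong2010ThetaFunctionsThetaDivisor] R. de Jong, Theta functions on the theta divisor, Rocky Mountain J. Math.
  40 (2010), Prop. 2.3, §1, §4.
* [GrushevskySalvatiManni2007PointsOfOrderTwo] S. Grushevsky, R. Salvati Manni, IMRN 2007, Lemma 2 (chunk p0007).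
* [EisenbudHarris2016] D. Eisenbud, J. Harris, 3264 and All That (2016), §7.4.3 Thm. 7.11.
* [LangeBirkenhake1992] Ch. Birkenhake, H. Lange, Complex Abelian Varieties (1992), §2.2.3 (p. 94).
-/

noncomputable section

open scoped Matrix Topology Real
open Set Function Module Complex Matrix
open Literature.Analysis.SpecialFunctions Literature.Analysis.Complex

namespace Literature.Geometry.Kaehler

namespace SCV

/-! ### §1 Bordered matrices: reindexing the family, zero vectors in the family -/

section BorderedFamily

variable {E : Type*} [NormedAddCommGroup E] [NormedSpace ℂ E] {ι ι' ι₁ ι₂ : Type*}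

/-- **`B[b ∘ σ] = B[b].submatrix (σ ⊕ 1) (σ ⊕ 1)`**: re-indexing the family re-indexes the bordered matrix.
[cite: GrushevskySalvatiManni2008, Definition 6 and Remark 7 (independence of the coordinates)] -/
theorem bordered_comp_equiv (T : E →L[ℂ] (E →L[ℂ] ℂ)) (ℓ : E →L[ℂ] ℂ) (b : ι → E) (σ : ι' → ι) :
    Matrix.fromBlocks (Matrix.of fun i j => T (b (σ i)) (b (σ j))) (Matrix.of fun i (_ : Unit) => ℓ (b (σ i)))
        (Matrix.of fun (_ : Unit) j => ℓ (b (σ j))) (0 : Matrix Unit Unit ℂ) =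
      (Matrix.fromBlocks (Matrix.of fun i j => T (b i) (b j)) (Matrix.of fun i (_ : Unit) => ℓ (b i))
        (Matrix.of fun (_ : Unit) j => ℓ (b j)) (0 : Matrix Unit Unit ℂ)).submatrix (Sum.map σ id) (Sum.map σ id) := by
  ext (i | i) (j | j) <;> rfl

/-- The rank of the bordered matrix does not depend on the indexing of the family (`σ` a bijection).
[cite: GrushevskySalvatiManni2008, Definition 6 and Remark 7] -/
theorem rank_bordered_comp_equiv [Fintype ι] [Fintype ι'] (T : E →L[ℂ] (E →L[ℂ] ℂ)) (ℓ : E →L[ℂ] ℂ)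
    (b : ι → E) (σ : ι' ≃ ι) :
    (Matrix.fromBlocks (Matrix.of fun i j => T (b (σ i)) (b (σ j))) (Matrix.of fun i (_ : Unit) => ℓ (b (σ i)))
        (Matrix.of fun (_ : Unit) j => ℓ (b (σ j))) (0 : Matrix Unit Unit ℂ)).rank =
      (Matrix.fromBlocks (Matrix.of fun i j => T (b i) (b j)) (Matrix.of fun i (_ : Unit) => ℓ (b i))
        (Matrix.of fun (_ : Unit) j => ℓ (b j)) (0 : Matrix Unit Unit ℂ)).rank := by
  rw [bordered_comp_equiv T ℓ b σ]
  exact Matrix.rank_submatrix _ (Equiv.sumCongr σ (Equiv.refl Unit)) (Equiv.sumCongr σ (Equiv.refl Unit))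

/-- **Zero vectors in the family: `B[(b₁, 0)] ≃ B[b₁] ⊕ 0`.** In the family `Sum.elim b₁ 0` on `ι₁ ⊕ ι₂` the
bordered matrix, after the shuffle `(ι₁ ⊕ 1) ⊕ ι₂ ≃ (ι₁ ⊕ ι₂) ⊕ 1`, is the block sum of `B[b₁]` and the zero
matrix on `ι₂` ("the last `g − k` columns … span a space of dimension at most …").
[cite: DeJong2010ThetaFunctionsThetaDivisor, Prop. 2.3, proof (chunk p0004)] -/
theorem bordered_sumElim_zero_submatrix (T : E →L[ℂ] (E →L[ℂ] ℂ)) (ℓ : E →L[ℂ] ℂ) (b₁ : ι₁ → E) :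
    (Matrix.fromBlocks
        (Matrix.of fun i j : ι₁ ⊕ ι₂ => T (Sum.elim b₁ (0 : ι₂ → E) i) (Sum.elim b₁ (0 : ι₂ → E) j))
        (Matrix.of fun (i : ι₁ ⊕ ι₂) (_ : Unit) => ℓ (Sum.elim b₁ (0 : ι₂ → E) i))
        (Matrix.of fun (_ : Unit) (j : ι₁ ⊕ ι₂) => ℓ (Sum.elim b₁ (0 : ι₂ → E) j)) (0 : Matrix Unit Unit ℂ)).submatrix
        ((Equiv.sumAssoc ι₁ Unit ι₂).trans (((Equiv.refl ι₁).sumCongr (Equiv.sumComm Unit ι₂)).trans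
          (Equiv.sumAssoc ι₁ ι₂ Unit).symm))
        ((Equiv.sumAssoc ι₁ Unit ι₂).trans (((Equiv.refl ι₁).sumCongr (Equiv.sumComm Unit ι₂)).trans
          (Equiv.sumAssoc ι₁ ι₂ Unit).symm)) =
      Matrix.fromBlocks
        (Matrix.fromBlocks (Matrix.of fun i j : ι₁ => T (b₁ i) (b₁ j)) (Matrix.of fun (i : ι₁) (_ : Unit) => ℓ (b₁ i))
          (Matrix.of fun (_ : Unit) (j : ι₁) => ℓ (b₁ j)) (0 : Matrix Unit Unit ℂ))
        0 0 (0 : Matrix ι₂ ι₂ ℂ) := by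
  ext ((i | i) | i) ((j | j) | j) <;>
    simp [Matrix.submatrix_apply, Equiv.sumAssoc, Equiv.sumComm, Matrix.fromBlocks]

/-- **`rank B[(b₁, 0, …, 0)] = rank B[b₁]`**: zero vectors in the family do not change the rank of the bordered
matrix. [cite: DeJong2010ThetaFunctionsThetaDivisor, Prop. 2.3, proof (chunk p0004)] -/
theorem rank_bordered_sumElim_zero [Fintype ι₁] [Fintype ι₂] [DecidableEq ι₁] [DecidableEq ι₂]
    (T : E →L[ℂ] (E →L[ℂ] ℂ)) (ℓ : E →L[ℂ] ℂ) (b₁ : ι₁ → E) :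
    (Matrix.fromBlocks
        (Matrix.of fun i j : ι₁ ⊕ ι₂ => T (Sum.elim b₁ (0 : ι₂ → E) i) (Sum.elim b₁ (0 : ι₂ → E) j))
        (Matrix.of fun (i : ι₁ ⊕ ι₂) (_ : Unit) => ℓ (Sum.elim b₁ (0 : ι₂ → E) i))
        (Matrix.of fun (_ : Unit) (j : ι₁ ⊕ ι₂) => ℓ (Sum.elim b₁ (0 : ι₂ → E) j)) (0 : Matrix Unit Unit ℂ)).rank =
      (Matrix.fromBlocks (Matrix.of fun i j : ι₁ => T (b₁ i) (b₁ j)) (Matrix.of fun (i : ι₁) (_ : Unit) => ℓ (b₁ i))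
        (Matrix.of fun (_ : Unit) (j : ι₁) => ℓ (b₁ j)) (0 : Matrix Unit Unit ℂ)).rank := by
  rw [← Matrix.rank_submatrix _
      ((Equiv.sumAssoc ι₁ Unit ι₂).trans (((Equiv.refl ι₁).sumCongr (Equiv.sumComm Unit ι₂)).trans
        (Equiv.sumAssoc ι₁ ι₂ Unit).symm))
      ((Equiv.sumAssoc ι₁ Unit ι₂).trans (((Equiv.refl ι₁).sumCongr (Equiv.sumComm Unit ι₂)).trans
        (Equiv.sumAssoc ι₁ ι₂ Unit).symm)),
    bordered_sumElim_zero_submatrix, Literature.LinearAlgebra.Matrix.rank_fromBlocks_zero₁₂_zero₂₁,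
    Matrix.rank_zero, add_zero]

/-- The same with the zero vectors first: `rank B[(0, …, 0, b₂)] = rank B[b₂]`.
[cite: DeJong2010ThetaFunctionsThetaDivisor, Prop. 2.3, proof (chunk p0004: "By symmetry")] -/
theorem rank_bordered_sumElim_zero_left [Fintype ι₁] [Fintype ι₂] [DecidableEq ι₁] [DecidableEq ι₂]
    (T : E →L[ℂ] (E →L[ℂ] ℂ)) (ℓ : E →L[ℂ] ℂ) (b₂ : ι₂ → E) :
    (Matrix.fromBlocks
        (Matrix.of fun i j : ι₁ ⊕ ι₂ => T (Sum.elim (0 : ι₁ → E) b₂ i) (Sum.elim (0 : ι₁ → E) b₂ j))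
        (Matrix.of fun (i : ι₁ ⊕ ι₂) (_ : Unit) => ℓ (Sum.elim (0 : ι₁ → E) b₂ i))
        (Matrix.of fun (_ : Unit) (j : ι₁ ⊕ ι₂) => ℓ (Sum.elim (0 : ι₁ → E) b₂ j)) (0 : Matrix Unit Unit ℂ)).rank =
      (Matrix.fromBlocks (Matrix.of fun i j : ι₂ => T (b₂ i) (b₂ j)) (Matrix.of fun (i : ι₂) (_ : Unit) => ℓ (b₂ i))
        (Matrix.of fun (_ : Unit) (j : ι₂) => ℓ (b₂ j)) (0 : Matrix Unit Unit ℂ)).rank := by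
  have h : (Sum.elim (0 : ι₁ → E) b₂) ∘ (Equiv.sumComm ι₂ ι₁) = Sum.elim b₂ (0 : ι₁ → E) := by
    funext i
    rcases i with i | i <;> rfl
  rw [← rank_bordered_comp_equiv T ℓ (Sum.elim (0 : ι₁ → E) b₂) (Equiv.sumComm ι₂ ι₁)]
  simp only [show ∀ i, Sum.elim (0 : ι₁ → E) b₂ ((Equiv.sumComm ι₂ ι₁) i) = Sum.elim b₂ (0 : ι₁ → E) i from
    fun i => congrFun h i]
  exact rank_bordered_sumElim_zero T ℓ b₂

end BorderedFamily

end SCV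

/-! ### §2 The Siegel model: the rank on the two sheets of `Θ_{Ω₁ ⊕ Ω₂}` -/

namespace ComplexTorus

open Literature.NumberTheory.Automorphic (siegelUpperHalfSpace)
open Literature.NumberTheory.ModularForms.SiegelUpperHalfSpace (moeb denom)

section BlockDiagRank

variable {n₁ n₂ : ℕ} {Ω₁ : Matrix (Fin n₁) (Fin n₁) ℂ} {Ω₂ : Matrix (Fin n₂) (Fin n₂) ℂ}
  {Ω : Matrix (Fin (n₁ + n₂)) (Fin (n₁ + n₂)) ℂ}
  (hΩ : Ω = Matrix.reindex finSumFinEquiv finSumFinEquiv (Matrix.fromBlocks Ω₁ 0 0 Ω₂))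
  (hpos₁ : (Matrix.of fun i j => (Ω₁ i j).im).PosDef) (hpos₂ : (Matrix.of fun i j => (Ω₂ i j).im).PosDef)

/-- `P₁ e_{castAdd i} = e′ᵢ`: the restriction to `ℂ^{n₁}` of a coordinate vector of the first block.
[cite: DeJong2010ThetaFunctionsThetaDivisor, Prop. 2.3, proof (chunk p0004)] -/
theorem restrictFst_single_castAdd (i : Fin n₁) :
    (ContinuousLinearMap.pi fun i : Fin n₁ =>
        ContinuousLinearMap.proj (R := ℂ) (φ := fun _ : Fin (n₁ + n₂) => ℂ) (Fin.castAdd n₂ i))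
      (Pi.single (Fin.castAdd n₂ i) (1 : ℂ)) = Pi.single i (1 : ℂ) := by
  funext i'
  rw [ContinuousLinearMap.pi_apply, ContinuousLinearMap.proj_apply]
  by_cases h : i' = i
  · subst h
    rw [Pi.single_eq_same, Pi.single_eq_same]
  · rw [Pi.single_eq_of_ne h, Pi.single_eq_of_ne (fun h' => h (Fin.castAdd_injective _ _ h'))]

/-- `P₂ e_{natAdd j} = e″ⱼ`. [cite: DeJong2010ThetaFunctionsThetaDivisor, Prop. 2.3, proof (chunk p0004)] -/
theorem restrictSnd_single_natAdd (j : Fin n₂) :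
    (ContinuousLinearMap.pi fun j : Fin n₂ =>
        ContinuousLinearMap.proj (R := ℂ) (φ := fun _ : Fin (n₁ + n₂) => ℂ) (Fin.natAdd n₁ j))
      (Pi.single (Fin.natAdd n₁ j) (1 : ℂ)) = Pi.single j (1 : ℂ) := by
  funext j'
  rw [ContinuousLinearMap.pi_apply, ContinuousLinearMap.proj_apply]
  by_cases h : j' = j
  · subst h
    rw [Pi.single_eq_same, Pi.single_eq_same]
  · rw [Pi.single_eq_of_ne h, Pi.single_eq_of_ne (fun h' => h (Fin.natAdd_injective _ _ h'))]

/-- The standard family of `ℂ^{n₁+n₂}` pushed to `ℂ^{n₁}` and re-indexed by `Fin n₁ ⊕ Fin n₂` is `(e′, 0)`.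
[cite: DeJong2010ThetaFunctionsThetaDivisor, Prop. 2.3, proof (chunk p0004)] -/
theorem restrictFst_single_finSumFinEquiv :
    (fun k : Fin n₁ ⊕ Fin n₂ => (ContinuousLinearMap.pi fun i : Fin n₁ =>
        ContinuousLinearMap.proj (R := ℂ) (φ := fun _ : Fin (n₁ + n₂) => ℂ) (Fin.castAdd n₂ i))
      (Pi.single (finSumFinEquiv k) (1 : ℂ))) =
      Sum.elim (fun i : Fin n₁ => (Pi.single i (1 : ℂ) : Fin n₁ → ℂ)) (0 : Fin n₂ → (Fin n₁ → ℂ)) := by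
  funext k
  rcases k with i | j
  · rw [finSumFinEquiv_apply_left, Sum.elim_inl, restrictFst_single_castAdd]
  · rw [finSumFinEquiv_apply_right, Sum.elim_inr, Pi.zero_apply, restrictFst_single_natAdd]

/-- The standard family of `ℂ^{n₁+n₂}` pushed to `ℂ^{n₂}` and re-indexed by `Fin n₁ ⊕ Fin n₂` is `(0, e″)`.
[cite: DeJong2010ThetaFunctionsThetaDivisor, Prop. 2.3, proof (chunk p0004)] -/
theorem restrictSnd_single_finSumFinEquiv :
    (fun k : Fin n₁ ⊕ Fin n₂ => (ContinuousLinearMap.pi fun j : Fin n₂ =>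
        ContinuousLinearMap.proj (R := ℂ) (φ := fun _ : Fin (n₁ + n₂) => ℂ) (Fin.natAdd n₁ j))
      (Pi.single (finSumFinEquiv k) (1 : ℂ))) =
      Sum.elim (0 : Fin n₁ → (Fin n₂ → ℂ)) (fun j : Fin n₂ => (Pi.single j (1 : ℂ) : Fin n₂ → ℂ)) := by
  funext k
  rcases k with i | j
  · rw [finSumFinEquiv_apply_left, Sum.elim_inl, Pi.zero_apply, restrictSnd_single_castAdd]
  · rw [finSumFinEquiv_apply_right, Sum.elim_inr, restrictSnd_single_natAdd]

include hΩ hpos₁ hpos₂ in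
/-- **THE RANK ON THE FIRST SHEET.** For `Z = Ω₁ ⊕ Ω₂` and `v ∈ ℂ^{n₁+n₂}` with `ϑ(P₁v, Ω₁) = 0`,
`ϑ(P₂v, Ω₂) ≠ 0` (a point of `Θ₁ × X₂` off `X₁ × Θ₂`):
`rank ( ϑ_{ij} ϑ_i ; ϑ_j 0 )(v) = rank ( F_{ij} F_i ; F_j 0 )(P₁v)` with `F = ϑ(·, Ω₁)` — de Jong's matrix
`( F_{ij}G F_iG_j F_iG ; F_jG_i FG_{ij} FG_j ; F_jG FG_j 0 )` at `F = 0` has the rank of `( F_{ij} F_i ; F_j 0 )`: the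
unit `G` does not change the rank (A2-207), and the `G`-block directions contribute zero vectors to the family
(§1). In particular the Thom–Boardman type of the Gauss map of `Θ_{Ω₁⊕Ω₂}` at `v` is that of `Θ_{Ω₁}` at `P₁v`.
[cite: DeJong2010ThetaFunctionsThetaDivisor, Prop. 2.3 and proof (chunk p0004)] [cite: GrushevskySalvatiManni2007PointsOfOrderTwo, Lemma 2 (chunk p0007)] -/
theorem rank_borderedHessian_riemannTheta_blockDiag_eq_of_fst (v : Fin (n₁ + n₂) → ℂ)
    (h₁ : riemannTheta Ω₁ (fun i => v (Fin.castAdd n₂ i)) = 0)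
    (h₂ : riemannTheta Ω₂ (fun j => v (Fin.natAdd n₁ j)) ≠ 0) :
    (Matrix.fromBlocks
        (Matrix.of fun i j : Fin (n₁ + n₂) => fderiv ℂ (fderiv ℂ (riemannTheta Ω)) v
          (Pi.single i (1 : ℂ)) (Pi.single j (1 : ℂ)))
        (Matrix.of fun (i : Fin (n₁ + n₂)) (_ : Unit) => fderiv ℂ (riemannTheta Ω) v (Pi.single i (1 : ℂ)))
        (Matrix.of fun (_ : Unit) (j : Fin (n₁ + n₂)) => fderiv ℂ (riemannTheta Ω) v (Pi.single j (1 : ℂ)))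
        (0 : Matrix Unit Unit ℂ)).rank =
      (Matrix.fromBlocks
        (Matrix.of fun i j : Fin n₁ => fderiv ℂ (fderiv ℂ (riemannTheta Ω₁)) (fun i => v (Fin.castAdd n₂ i))
          (Pi.single i (1 : ℂ)) (Pi.single j (1 : ℂ)))
        (Matrix.of fun (i : Fin n₁) (_ : Unit) => fderiv ℂ (riemannTheta Ω₁) (fun i => v (Fin.castAdd n₂ i))
          (Pi.single i (1 : ℂ)))
        (Matrix.of fun (_ : Unit) (j : Fin n₁) => fderiv ℂ (riemannTheta Ω₁) (fun i => v (Fin.castAdd n₂ i))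
          (Pi.single j (1 : ℂ)))
        (0 : Matrix Unit Unit ℂ)).rank := by
  have hd₁ := differentiable_riemannTheta_of_posDef_im hpos₁
  have hd₂ := differentiable_riemannTheta_of_posDef_im hpos₂
  set P₁ : (Fin (n₁ + n₂) → ℂ) →L[ℂ] (Fin n₁ → ℂ) := ContinuousLinearMap.pi fun i : Fin n₁ =>
    ContinuousLinearMap.proj (R := ℂ) (φ := fun _ : Fin (n₁ + n₂) => ℂ) (Fin.castAdd n₂ i) with hP₁
  set P₂ : (Fin (n₁ + n₂) → ℂ) →L[ℂ] (Fin n₂ → ℂ) := ContinuousLinearMap.pi fun j : Fin n₂ =>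
    ContinuousLinearMap.proj (R := ℂ) (φ := fun _ : Fin (n₁ + n₂) => ℂ) (Fin.natAdd n₁ j) with hP₂
  have hP₁v : P₁ v = fun i => v (Fin.castAdd n₂ i) := rfl
  have hP₂v : P₂ v = fun j => v (Fin.natAdd n₁ j) := rfl
  have hfP : Differentiable ℂ fun u => riemannTheta Ω₁ (P₁ u) := hd₁.comp P₁.differentiable
  have hgQ : Differentiable ℂ fun u => riemannTheta Ω₂ (P₂ u) := hd₂.comp P₂.differentiable
  -- `ϑ(·,Ω) = (ϑ₂ ∘ P₂) · (ϑ₁ ∘ P₁)`; the unit factor does not change the rank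
  rw [riemannTheta_blockDiag_eq_mul_comp hΩ hpos₁ hpos₂,
    SCV.rank_borderedHessian_mul (f := fun u => riemannTheta Ω₁ (P₁ u)) (g := fun u => riemannTheta Ω₂ (P₂ u))
      hfP hgQ (v := v) (by rw [hP₁v]; exact h₁) (by rw [hP₂v]; exact h₂)
      (fun k => (Pi.single k (1 : ℂ) : Fin (n₁ + n₂) → ℂ)),
    SCV.bordered_comp_clm hd₁ P₁ v (fun k => (Pi.single k (1 : ℂ) : Fin (n₁ + n₂) → ℂ))]
  -- re-index the family by `Fin n₁ ⊕ Fin n₂`: it becomes `(e′, 0)`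
  rw [← SCV.rank_bordered_comp_equiv (fderiv ℂ (fderiv ℂ (riemannTheta Ω₁)) (P₁ v)) (fderiv ℂ (riemannTheta Ω₁) (P₁ v))
      (fun k => P₁ (Pi.single k (1 : ℂ))) finSumFinEquiv]
  have hfam := restrictFst_single_finSumFinEquiv (n₁ := n₁) (n₂ := n₂)
  simp only [show ∀ k : Fin n₁ ⊕ Fin n₂, P₁ (Pi.single (finSumFinEquiv k) (1 : ℂ)) =
      Sum.elim (fun i : Fin n₁ => (Pi.single i (1 : ℂ) : Fin n₁ → ℂ)) (0 : Fin n₂ → (Fin n₁ → ℂ)) k from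
    fun k => congrFun hfam k]
  rw [SCV.rank_bordered_sumElim_zero, hP₁v]

include hΩ hpos₁ hpos₂ in
/-- **THE RANK ON THE SECOND SHEET** (`ϑ(P₂v, Ω₂) = 0`, `ϑ(P₁v, Ω₁) ≠ 0`): `rank B_{ϑ(·,Ω)}(v)[e] =
rank B_{ϑ(·,Ω₂)}(P₂v)[e″]` ("By symmetry"). [cite: DeJong2010ThetaFunctionsThetaDivisor, Prop. 2.3 and proof (chunk p0004)] -/
theorem rank_borderedHessian_riemannTheta_blockDiag_eq_of_snd (v : Fin (n₁ + n₂) → ℂ)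
    (h₂ : riemannTheta Ω₂ (fun j => v (Fin.natAdd n₁ j)) = 0)
    (h₁ : riemannTheta Ω₁ (fun i => v (Fin.castAdd n₂ i)) ≠ 0) :
    (Matrix.fromBlocks
        (Matrix.of fun i j : Fin (n₁ + n₂) => fderiv ℂ (fderiv ℂ (riemannTheta Ω)) v
          (Pi.single i (1 : ℂ)) (Pi.single j (1 : ℂ)))
        (Matrix.of fun (i : Fin (n₁ + n₂)) (_ : Unit) => fderiv ℂ (riemannTheta Ω) v (Pi.single i (1 : ℂ)))
        (Matrix.of fun (_ : Unit) (j : Fin (n₁ + n₂)) => fderiv ℂ (riemannTheta Ω) v (Pi.single j (1 : ℂ)))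
        (0 : Matrix Unit Unit ℂ)).rank =
      (Matrix.fromBlocks
        (Matrix.of fun i j : Fin n₂ => fderiv ℂ (fderiv ℂ (riemannTheta Ω₂)) (fun j => v (Fin.natAdd n₁ j))
          (Pi.single i (1 : ℂ)) (Pi.single j (1 : ℂ)))
        (Matrix.of fun (i : Fin n₂) (_ : Unit) => fderiv ℂ (riemannTheta Ω₂) (fun j => v (Fin.natAdd n₁ j))
          (Pi.single i (1 : ℂ)))
        (Matrix.of fun (_ : Unit) (j : Fin n₂) => fderiv ℂ (riemannTheta Ω₂) (fun j => v (Fin.natAdd n₁ j))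
          (Pi.single j (1 : ℂ)))
        (0 : Matrix Unit Unit ℂ)).rank := by
  have hd₁ := differentiable_riemannTheta_of_posDef_im hpos₁
  have hd₂ := differentiable_riemannTheta_of_posDef_im hpos₂
  set P₁ : (Fin (n₁ + n₂) → ℂ) →L[ℂ] (Fin n₁ → ℂ) := ContinuousLinearMap.pi fun i : Fin n₁ =>
    ContinuousLinearMap.proj (R := ℂ) (φ := fun _ : Fin (n₁ + n₂) => ℂ) (Fin.castAdd n₂ i) with hP₁
  set P₂ : (Fin (n₁ + n₂) → ℂ) →L[ℂ] (Fin n₂ → ℂ) := ContinuousLinearMap.pi fun j : Fin n₂ =>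
    ContinuousLinearMap.proj (R := ℂ) (φ := fun _ : Fin (n₁ + n₂) => ℂ) (Fin.natAdd n₁ j) with hP₂
  have hP₁v : P₁ v = fun i => v (Fin.castAdd n₂ i) := rfl
  have hP₂v : P₂ v = fun j => v (Fin.natAdd n₁ j) := rfl
  have hfP : Differentiable ℂ fun u => riemannTheta Ω₁ (P₁ u) := hd₁.comp P₁.differentiable
  have hgQ : Differentiable ℂ fun u => riemannTheta Ω₂ (P₂ u) := hd₂.comp P₂.differentiable
  rw [riemannTheta_blockDiag_eq_mul_comp hΩ hpos₁ hpos₂, mul_comm,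
    SCV.rank_borderedHessian_mul (f := fun u => riemannTheta Ω₂ (P₂ u)) (g := fun u => riemannTheta Ω₁ (P₁ u))
      hgQ hfP (v := v) (by rw [hP₂v]; exact h₂) (by rw [hP₁v]; exact h₁)
      (fun k => (Pi.single k (1 : ℂ) : Fin (n₁ + n₂) → ℂ)),
    SCV.bordered_comp_clm hd₂ P₂ v (fun k => (Pi.single k (1 : ℂ) : Fin (n₁ + n₂) → ℂ))]
  rw [← SCV.rank_bordered_comp_equiv (fderiv ℂ (fderiv ℂ (riemannTheta Ω₂)) (P₂ v)) (fderiv ℂ (riemannTheta Ω₂) (P₂ v))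
      (fun k => P₂ (Pi.single k (1 : ℂ))) finSumFinEquiv]
  have hfam := restrictSnd_single_finSumFinEquiv (n₁ := n₁) (n₂ := n₂)
  simp only [show ∀ k : Fin n₁ ⊕ Fin n₂, P₂ (Pi.single (finSumFinEquiv k) (1 : ℂ)) =
      Sum.elim (0 : Fin n₁ → (Fin n₂ → ℂ)) (fun j : Fin n₂ => (Pi.single j (1 : ℂ) : Fin n₂ → ℂ)) k from
    fun k => congrFun hfam k]
  rw [SCV.rank_bordered_sumElim_zero_left, hP₂v]

include hΩ hpos₁ hpos₂ in
/-- **On the first sheet the rank is at most `n₁ + 1`** — never the maximal `n₁ + n₂ + 1` when `n₂ ≥ 1`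
(the rank form of A2-213's `det = 0`: every point of `Θ₁ × X₂` is a ramification point of the Gauss map).
[cite: DeJong2010ThetaFunctionsThetaDivisor, Prop. 2.3 (chunk p0004: "span a space of dimension at most `g − k − 1`")] [cite: GrushevskySalvatiManni2007PointsOfOrderTwo, Lemma 2 (chunk p0007)] -/
theorem rank_borderedHessian_riemannTheta_blockDiag_le_of_fst (v : Fin (n₁ + n₂) → ℂ)
    (h₁ : riemannTheta Ω₁ (fun i => v (Fin.castAdd n₂ i)) = 0)
    (h₂ : riemannTheta Ω₂ (fun j => v (Fin.natAdd n₁ j)) ≠ 0) :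
    (Matrix.fromBlocks
        (Matrix.of fun i j : Fin (n₁ + n₂) => fderiv ℂ (fderiv ℂ (riemannTheta Ω)) v
          (Pi.single i (1 : ℂ)) (Pi.single j (1 : ℂ)))
        (Matrix.of fun (i : Fin (n₁ + n₂)) (_ : Unit) => fderiv ℂ (riemannTheta Ω) v (Pi.single i (1 : ℂ)))
        (Matrix.of fun (_ : Unit) (j : Fin (n₁ + n₂)) => fderiv ℂ (riemannTheta Ω) v (Pi.single j (1 : ℂ)))
        (0 : Matrix Unit Unit ℂ)).rank ≤ n₁ + 1 := by
  rw [rank_borderedHessian_riemannTheta_blockDiag_eq_of_fst hΩ hpos₁ hpos₂ v h₁ h₂]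
  refine (Matrix.rank_le_card_width _).trans ?_
  simp

/-! ### §3 Along the `Sp_{2g}(ℤ)`-orbit -/

variable (hΩ₁ : ∀ i j, Ω₁ i j = Ω₁ j i) (hΩ₂ : ∀ i j, Ω₂ i j = Ω₂ j i)

include hΩ hpos₁ hpos₂ hΩ₁ hΩ₂ in
/-- **THE RANK ALONG THE DECOMPOSABLE LOCUS.** For `M ∈ Sp_{2g}(ℤ)`, `g = n₁ + n₂ ≥ 1`, `D = γΩ + δ` and
`v ∈ ℂ^g` on the first sheet of `Θ_{Ω₁⊕Ω₂}` (`ϑ(P₁v,Ω₁) = 0`, `ϑ(P₂v,Ω₂) ≠ 0`), at the corresponding zero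
`w = ᵗD⁻¹v` of `ϑ[M[0]](·, M(Ω₁ ⊕ Ω₂))`:
`rank ( ϑ_{ij} ϑ_i ; ϑ_j 0 )(w) = rank ( F_{ij} F_i ; F_j 0 )(P₁v)`, `F = ϑ(·,Ω₁)` — the rank is a modular invariant
(A2-210) and on `Ω₁ ⊕ Ω₂` it is that of the factor (§2): the Thom–Boardman type of the Gauss map of the theta divisor
of every p.p.a.v. in `Sp_{2g}(ℤ)·(𝔥_{n₁} × 𝔥_{n₂})` is read off on `Θ₁`.
[cite: DeJong2010ThetaFunctionsThetaDivisor, Prop. 2.3 (chunk p0004) and §4, proof of Thm. 1.3 (chunk p0008)] [cite: GrushevskySalvatiManni2008, Definition 5 (p0004 of the held text)] -/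
theorem rank_borderedHessian_riemannThetaChar_moeb_blockDiag_eq_of_fst [NeZero (n₁ + n₂)]
    {M : Matrix (Fin (n₁ + n₂) ⊕ Fin (n₁ + n₂)) (Fin (n₁ + n₂) ⊕ Fin (n₁ + n₂)) ℤ}
    (hM : M ∈ Matrix.symplecticGroup (Fin (n₁ + n₂)) ℤ) (v : Fin (n₁ + n₂) → ℂ)
    (h₁ : riemannTheta Ω₁ (fun i => v (Fin.castAdd n₂ i)) = 0)
    (h₂ : riemannTheta Ω₂ (fun j => v (Fin.natAdd n₁ j)) ≠ 0) :
    (Matrix.fromBlocks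
        (Matrix.of fun i j : Fin (n₁ + n₂) => fderiv ℂ (fderiv ℂ (riemannThetaChar (thetaCharFst M 0 0)
          (thetaCharSnd M 0 0) (moeb (M.map ((↑) : ℤ → ℂ)) Ω)))
          ((denom (M.map ((↑) : ℤ → ℂ)) Ω)ᵀ⁻¹ *ᵥ v) (Pi.single i (1 : ℂ)) (Pi.single j (1 : ℂ)))
        (Matrix.of fun (i : Fin (n₁ + n₂)) (_ : Unit) => fderiv ℂ (riemannThetaChar (thetaCharFst M 0 0)
          (thetaCharSnd M 0 0) (moeb (M.map ((↑) : ℤ → ℂ)) Ω))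
          ((denom (M.map ((↑) : ℤ → ℂ)) Ω)ᵀ⁻¹ *ᵥ v) (Pi.single i (1 : ℂ)))
        (Matrix.of fun (_ : Unit) (j : Fin (n₁ + n₂)) => fderiv ℂ (riemannThetaChar (thetaCharFst M 0 0)
          (thetaCharSnd M 0 0) (moeb (M.map ((↑) : ℤ → ℂ)) Ω))
          ((denom (M.map ((↑) : ℤ → ℂ)) Ω)ᵀ⁻¹ *ᵥ v) (Pi.single j (1 : ℂ)))
        (0 : Matrix Unit Unit ℂ)).rank =
      (Matrix.fromBlocks
        (Matrix.of fun i j : Fin n₁ => fderiv ℂ (fderiv ℂ (riemannTheta Ω₁)) (fun i => v (Fin.castAdd n₂ i))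
          (Pi.single i (1 : ℂ)) (Pi.single j (1 : ℂ)))
        (Matrix.of fun (i : Fin n₁) (_ : Unit) => fderiv ℂ (riemannTheta Ω₁) (fun i => v (Fin.castAdd n₂ i))
          (Pi.single i (1 : ℂ)))
        (Matrix.of fun (_ : Unit) (j : Fin n₁) => fderiv ℂ (riemannTheta Ω₁) (fun i => v (Fin.castAdd n₂ i))
          (Pi.single j (1 : ℂ)))
        (0 : Matrix Unit Unit ℂ)).rank := by
  have hZ : Ω ∈ siegelUpperHalfSpace (n₁ + n₂) :=
    blockDiag_mem_siegelUpperHalfSpace Ω₁ Ω₂ hΩ hΩ₁ hpos₁ hΩ₂ hpos₂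
  have hv0 : riemannTheta Ω v = 0 := by
    rw [riemannTheta_blockDiag_of_posDef hΩ hpos₁ hpos₂ v, h₁, zero_mul]
  have hv0' : riemannThetaChar 0 0 Ω v = 0 := by rwa [riemannThetaChar_zero_zero]
  have hF : riemannThetaChar 0 0 Ω = riemannTheta Ω := funext (riemannThetaChar_zero_zero Ω)
  rw [rank_borderedHessian_riemannThetaChar_moeb_mulVec_eq hM hZ 0 0 hv0', hF]
  exact rank_borderedHessian_riemannTheta_blockDiag_eq_of_fst hΩ hpos₁ hpos₂ v h₁ h₂

end BlockDiagRank

end ComplexTorus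

end Literature.Geometry.Kaehler
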